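/- Width seat `ym-line-cbag-p1-w2` (prover-ym-line-cbag-p1-w2-g14-0; own items stmt-QuantumFields-22254 / 22893 CLOSED) on the
planner-of-record's LINE 5, route `HankelDensitySplitting`: helper for REGISTERED STUB 1 `stub_hankelFixedDistanceLower` of the birth
skeleton of crux `HankelDensityFloor` (stmt-QuantumFields-26618).  RECORD-type material (node `LatticeNonFreezing`); the Yang–Mills mass
gap is NOT proved by anything here, and the crux stays open. -/
import Summits.QuantumFields.YangMills.Theorems.DirichletWindowLocalGaussianitySecondOrder
import Summits.QuantumFields.YangMills.Theorems.HankelDensitySplittingHankelDensityFloorNearUpper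
import HarnessLib

/-!
# The second-order local free-gluon law for an ARBITRARY PAIR of plaquettes

Support file for crux `HankelDensityFloor` (stmt-QuantumFields-26618) of route `HankelDensitySplitting`, stub 1
`HankelFixedDistanceLower` (the cross-plane fixed-position second-order local law).  Route-independent content (no `Theses` decl of
`HankelDensitySplitting` is used; the sibling stub file `…HankelDensityFloorNearUpper` is imported only for the axis-permutation
bookkeeping `exists_perm_symm_eq`):

* `PairLaw.cov_scaled_eq` — the covariance of two scaled plaquette costs `β(N − P)`, `β(N − Q)` is `β²·(E[PQ] − E[P]E[Q])`;
* `PairLaw.expMoment_allPlanes` — the chessboard exponential moment `E_μ exp((β/2)(N − Re tr r(U_{(x;i,j)}))) ≤ C` for EVERY site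
  and EVERY plane `i < j`, uniformly over torus-limit states at weak coupling: the landed `(0,1)`-plane bound
  `LocalGaussianity.ExpMomentTangentLaw.stub_expMomentBound`, transported by a permutation of the coordinate axes
  (`map_configPermZd_mem_infiniteVolumeLimitPoints`, `plaquetteObs_configPermZd`);
* `PairLaw.pairLocalLaw` — **the pair law**: for a compact simple `G` and a faithful unitary lattice representation `r` there is
  `D ≥ 1` (the tangent-law dimension) such that for all plaquettes `p = (x;i,j)`, `q = (y;k,l)` and `ε > 0`, eventually in `β` and
  uniformly over `μ ∈ infiniteVolumeLimitPoints r.ρ β`,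
  `|β²·plaquetteCorr r.ρ μ x i j y k l − (D/2)·curvatureTwoPoint p q ²| < ε`.
  Proof = the landed axis engine `SecondOrder.secondOrder_of_expMoment` (Theorems/DirichletWindowLocalGaussianitySecondOrder) run for
  a general pair: a bad sequence `β_k → ∞`, `μ_k` has a tangent law (`EquipartitionPinsProbe.stub_tangent`, fed with `stub_equipartition`
  and the closed free-energy constant term `DirichletWindow.FreeEnergyLogCoefficient_holds`), identified by `stub_rigidity` as
  `curvatureGaussianField 4 D`; (T0) at the two plaquettes with clamped test functions gives the truncated covariances; the truncation
  error is `O(1/M)` uniformly by the exponential moments (`abs_cov_sub_truncated_le`); on the Gaussian side the truncated covariances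
  converge to `(D/2) c_{pq}²` (`GaussMoments.tendsto_truncated_cov`, Isserlis);
* `PairLaw.pairLocalLaw_lower` — the one-sided corollary `−ε < β²·plaquetteCorr` eventually (the Gaussian limit is a square).

References: S. Chatterjee, arXiv:1602.01222 §§11–14, arXiv:1803.01950 Problem 5.1; Fröhlich–Israel–Lieb–Simon, CMP 62 (1978).
[folklore] bookkeeping over the landed engine; no rung or summit statement is proved here.
-/

set_option autoImplicit false

noncomputable section

open MeasureTheory Filter Topology
open Literature.MathematicalPhysics.QuantumFieldTheory Literature.MathematicalPhysics.QuantumLattice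
open Summit.QuantumFields.YangMills.Theorems.LocalGaussianityExpMomentTangentLaw
open Summit.QuantumFields.YangMills.Theorems.LocalGaussianityExpMomentTangentLaw.SecondOrder
  (integrable_of_abs_le abs_cov_sub_truncated_le)

namespace Summit.QuantumFields.YangMills.Theorems.HankelDensitySplitting

namespace PairLaw

/-! ### Covariance of two scaled plaquette costs -/

/-- For integrable real observables `P, Q` on a probability space: the covariance of the scaled costs `β(N − P)`, `β(N − Q)` is
`β² · (E[PQ] − E[P]E[Q])`. [folklore] -/
theorem cov_scaled_eq {Ω : Type*} [MeasurableSpace Ω] (μ : Measure Ω) [IsProbabilityMeasure μ] (β c : ℝ)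
    {P Q : Ω → ℝ} (hP : Integrable P μ) (hQ : Integrable Q μ) (hPQ : Integrable (fun U => P U * Q U) μ) :
    (∫ U, (β * (c - P U)) * (β * (c - Q U)) ∂μ) -
      (∫ U, β * (c - P U) ∂μ) * (∫ U, β * (c - Q U) ∂μ) =
      β ^ 2 * ((∫ U, P U * Q U ∂μ) - (∫ U, P U ∂μ) * (∫ U, Q U ∂μ)) := by
  have hprod : ∀ U, (β * (c - P U)) * (β * (c - Q U)) =
      β ^ 2 * c ^ 2 - β ^ 2 * c * Q U - β ^ 2 * c * P U + β ^ 2 * (P U * Q U) := fun U => by ring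
  have hlin : ∀ {R : Ω → ℝ}, Integrable R μ → ∫ U, β * (c - R U) ∂μ = β * c - β * ∫ U, R U ∂μ := by
    intro R hR
    rw [integral_const_mul, integral_sub (integrable_const _) hR, integral_const, probReal_univ, one_smul]
    ring
  simp_rw [hprod]
  have i1 : Integrable (fun U => β ^ 2 * c ^ 2 - β ^ 2 * c * Q U - β ^ 2 * c * P U) μ :=
    ((integrable_const _).sub (hQ.const_mul _)).sub (hP.const_mul _)
  have i2 : Integrable (fun U => β ^ 2 * (P U * Q U)) μ := hPQ.const_mul _
  have i3 : Integrable (fun U => β ^ 2 * c ^ 2 - β ^ 2 * c * Q U) μ := (integrable_const _).sub (hQ.const_mul _)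
  have i4 : Integrable (fun U => β ^ 2 * c * Q U) μ := hQ.const_mul _
  have i5 : Integrable (fun U => β ^ 2 * c * P U) μ := hP.const_mul _
  rw [integral_add i1 i2, integral_sub i3 i5, integral_sub (integrable_const _) i4, integral_const,
    probReal_univ, one_smul, integral_const_mul, integral_const_mul, integral_const_mul, hlin hP, hlin hQ]
  ring

/-! ### Exponential moments in every plane -/

section Lattice

variable {N : ℕ} {G : Type} [Group G] [TopologicalSpace G] [IsTopologicalGroup G] [CompactSpace G]
  [MeasurableSpace G] [BorelSpace G]

/-- `sitePermZd π.symm` undoes `sitePermZd π`. [folklore] -/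
theorem sitePermZd_symm_sitePermZd (π : Equiv.Perm (Fin 4)) (x : Literature.Probability.LatticeModels.Site 4) :
    sitePermZd π.symm (sitePermZd π x) = x := by
  funext j
  simp only [sitePermZd_apply, Equiv.symm_symm, Equiv.symm_apply_apply]

/-- **Transport of a one-plaquette bound to every plane.**  If a bound `∫ F(Re tr ρ(U_{(x;0,1)})) dν ≤ C` holds for every limit state
`ν` at `β` and every site `x`, then it holds for every limit state `μ`, every site and every plane `i < j`: the axis permutation
`(configPermZd π)_* μ` with `π⁻¹ 0 = i`, `π⁻¹ 1 = j` is again a limit state. [folklore] -/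
theorem integral_plaquetteObs_le_of_forall_plane01 (ρ : G →* Matrix (Fin N) (Fin N) ℂ) (hρ : Continuous ρ) {β C : ℝ}
    (F : ℝ → ℝ)
    (hb : ∀ ν ∈ infiniteVolumeLimitPoints (d := 4) ρ β, ∀ x : Literature.Probability.LatticeModels.Site 4,
      ∫ U, F (plaquetteObs ρ x 0 1 U) ∂ν ≤ C)
    {μ : Measure (LGConfig 4 G)} (hμ : μ ∈ infiniteVolumeLimitPoints (d := 4) ρ β)
    (x : Literature.Probability.LatticeModels.Site 4) {i j : Fin 4} (hij : i < j) :
    ∫ U, F (plaquetteObs ρ x i j U) ∂μ ≤ C := by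
  obtain ⟨π, hπ0, hπ1⟩ := exists_perm_symm_eq i j hij
  have h2 := map_configPermZd_mem_infiniteVolumeLimitPoints ρ hρ hμ π
  have key := hb _ h2 (sitePermZd π x)
  simp only [integral_map_equiv, plaquetteObs_configPermZd, sitePermZd_symm_sitePermZd, hπ0, hπ1] at key
  exact key

end Lattice

/-- **Chessboard exponential moments in every plane.**  For a compact simple `G` and a faithful unitary lattice representation `r`:
`∃ C β₁, ∀ β ≥ β₁, ∀ μ ∈ infiniteVolumeLimitPoints r.ρ β, ∀ x, ∀ i < j, ∫ exp((β/2)(N − Re tr r(U_{(x;i,j)}))) dμ ≤ C` — the landed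
`(0,1)`-plane bound `stub_expMomentBound` transported by axis permutations of the limit states. [folklore] -/
theorem expMoment_allPlanes :
    ∀ (G : Type) [Group G] [TopologicalSpace G] [IsTopologicalGroup G] [CompactSpace G] [MeasurableSpace G] [BorelSpace G],
      IsCompactSimpleLieGroup G → ∀ r : LatticeRep G, ∃ C β₁ : ℝ, ∀ β : ℝ, β₁ ≤ β →
        ∀ μ ∈ infiniteVolumeLimitPoints (d := 4) r.ρ β, ∀ (x : Literature.Probability.LatticeModels.Site 4) (i j : Fin 4),
          i < j → ∫ U, Real.exp (β / 2 * ((r.N : ℝ) - plaquetteObs r.ρ x i j U)) ∂μ ≤ C := by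
  intro G _ _ _ _ _ _ hG r
  obtain ⟨C, β₁, h⟩ := Summit.QuantumFields.YangMills.Cruxes.LocalGaussianity.ExpMomentTangentLaw.stub_expMomentBound G hG r
  refine ⟨C, β₁, fun β hβ μ hμ x i j hij => ?_⟩
  exact integral_plaquetteObs_le_of_forall_plane01 r.ρ r.continuous (fun t => Real.exp (β / 2 * ((r.N : ℝ) - t)))
    (h β hβ) hμ x hij

/-! ### The pair law (contradiction wrapper over the tangent law) -/

open Summit.QuantumFields.YangMills.Theorems.EquipartitionPinsProbe in
/-- **The second-order local free-gluon law for an arbitrary pair of plaquettes.**  For a compact simple `G` and a faithful unitary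
lattice representation `r` there is `D ≥ 1` such that for all plaquettes `p = (x;i,j)`, `q = (y;k,l)` of `ℤ⁴` and every `ε > 0` there
is `β₁` with `|β²·plaquetteCorr r.ρ μ x i j y k l − (D/2)·(curvatureTwoPoint p q)²| < ε` for all `β ≥ β₁` and all
`μ ∈ infiniteVolumeLimitPoints r.ρ β` — the axis engine `SecondOrder.secondOrder_of_expMoment` run for a general pair (tangent law +
rigidity ⇒ `curvatureGaussianField 4 D`; uniform integrability from `expMoment_allPlanes`; Isserlis `GaussMoments.tendsto_truncated_cov`).
Fixed positions as `β → ∞`; NOT a mass gap, NOT volume-uniform clustering. -/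
theorem pairLocalLaw :
    ∀ (G : Type) [Group G] [TopologicalSpace G] [IsTopologicalGroup G] [CompactSpace G] [MeasurableSpace G] [BorelSpace G],
      IsCompactSimpleLieGroup G → ∀ r : LatticeRep G, ∃ D : ℕ, 0 < D ∧
        ∀ (p q : ZdPlaquette 4) (ε : ℝ), 0 < ε → ∃ β₁ : ℝ, ∀ β : ℝ, β₁ ≤ β →
          ∀ μ ∈ infiniteVolumeLimitPoints (d := 4) r.ρ β,
            |β ^ 2 * plaquetteCorr r.ρ μ p.1 p.2.1.1 p.2.1.2 q.1 q.2.1.1 q.2.1.2 -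
              (D : ℝ) / 2 * curvatureTwoPoint p q ^ 2| < ε := by
  intro G _ _ _ _ mG hBG hG r
  have hm : mG = borel G := @BorelSpace.measurable_eq G _ mG hBG
  subst hm
  letI : MeasurableSpace G := borel G
  haveI : SecondCountableTopology G :=
    (r.continuous.isClosedEmbedding r.injective).isEmbedding.secondCountableTopology
  have hK := Summit.QuantumFields.YangMills.Theses.DirichletWindow.FreeEnergyLogCoefficient_holds G hG r
  obtain ⟨D, hD, hTan⟩ := stub_tangent G hG r (stub_equipartition G hG r hK)
  have hR := stub_rigidity
    (stub_factorization (stub_exactShiftInvariance stub_steinFlow stub_kernelFixesExact)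
      (stub_cubeShiftInvariance stub_kernelClosed) stub_density)
    stub_cosMoment stub_lineVariance stub_gaussFromCharFun
  obtain ⟨C, β₁, hC⟩ := expMoment_allPlanes G hG r
  refine ⟨D, hD, fun p0 pn ε hε => ?_⟩
  set L : ℝ := (D : ℝ) / 2 * curvatureTwoPoint p0 pn ^ 2 with hL
  by_contra hcon
  push Not at hcon
  choose βs hβs μs hμs hbad using fun k : ℕ => hcon (max (k : ℝ) β₁)
  have hβk : ∀ k : ℕ, (k : ℝ) ≤ βs k := fun k => (le_max_left _ _).trans (hβs k)
  have hβ1 : ∀ k, β₁ ≤ βs k := fun k => (le_max_right _ _).trans (hβs k)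
  have hβ0 : ∀ k, 0 ≤ βs k := fun k => (Nat.cast_nonneg k).trans (hβk k)
  have hβtend : Tendsto βs atTop atTop := tendsto_atTop_mono hβk tendsto_natCast_atTop_atTop
  obtain ⟨φ, τ, hφ, hτ, hT0, hT1, hT2, hT3⟩ := hTan βs μs hβtend hμs
  have hτeq : τ = curvatureGaussianField 4 D := hR D τ hτ hT1 hT2 hT3
  subst hτeq
  have hprob : ∀ k, IsProbabilityMeasure (μs k) := fun k => by
    obtain ⟨Lk, -, hP, -⟩ := hμs k
    exact hP
  -- the plaquette observables (as functions of a plaquette) and the scaled costs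
  set P : ZdPlaquette 4 → LGConfig 4 G → ℝ := fun q U => plaquetteObs r.ρ q.1 q.2.1.1 q.2.1.2 U with hP
  have hPc : ∀ q : ZdPlaquette 4, Continuous (P q) := fun q => continuous_plaquetteObs r.ρ r.continuous q.1 q.2.1.1 q.2.1.2
  have hPabs : ∀ (q : ZdPlaquette 4) (U : LGConfig 4 G), |P q U| ≤ r.N := fun q U => by
    have h := Literature.RepresentationTheory.CompactGroups.CompactGroup.abs_re_trace_le_card r.ρ r.continuous
      (plaquetteHolonomyZd U q.1 q.2.1.1 q.2.1.2)
    simpa only [Fintype.card_fin, plaquetteObs, hP] using h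
  have hPi : ∀ (k : ℕ) (q : ZdPlaquette 4), Integrable (P q) (μs k) := fun k q => by
    haveI := hprob k
    exact integrable_of_abs_le (hPc q).aestronglyMeasurable (hPabs q)
  have hPPi : ∀ (k : ℕ) (q q' : ZdPlaquette 4), Integrable (fun U => P q U * P q' U) (μs k) := fun k q q' => by
    haveI := hprob k
    exact integrable_of_abs_le ((hPc q).mul (hPc q')).aestronglyMeasurable (K := (r.N : ℝ) * r.N) fun U => by
      rw [abs_mul]
      exact mul_le_mul (hPabs q U) (hPabs q' U) (abs_nonneg _) (Nat.cast_nonneg _)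
  set X : ℕ → ZdPlaquette 4 → LGConfig 4 G → ℝ := fun k q U => βs k * ((r.N : ℝ) - P q U) with hX
  have hX0 : ∀ k q U, 0 ≤ X k q U := fun k q U =>
    mul_nonneg (hβ0 k) (sub_nonneg.2 (abs_le.1 (hPabs q U)).2)
  have hXB : ∀ k q U, X k q U ≤ βs k * (2 * r.N) := fun k q U =>
    mul_le_mul_of_nonneg_left (by linarith [(abs_le.1 (hPabs q U)).1]) (hβ0 k)
  have hXm : ∀ k q, AEStronglyMeasurable (X k q) (μs k) := fun k q =>
    (continuous_const.mul (continuous_const.sub (hPc q))).aestronglyMeasurable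
  have hXe : ∀ (k : ℕ) (q : ZdPlaquette 4), ∫ U, Real.exp (X k q U / 2) ∂(μs k) ≤ C := fun k q => by
    have h := hC (βs k) (hβ1 k) (μs k) (hμs k) q.1 q.2.1.1 q.2.1.2 q.2.2
    have heq : (fun U => Real.exp (X k q U / 2)) =
        fun U => Real.exp (βs k / 2 * ((r.N : ℝ) - plaquetteObs r.ρ q.1 q.2.1.1 q.2.1.2 U)) := by
      funext U
      congr 1
      simp only [hX, hP]
      ring
    rw [heq]
    exact h
  -- uniform truncation error (the exponential moments give uniform integrability)
  have htrunc : ∀ (k : ℕ) {M : ℝ}, 0 < M →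
      |((∫ U, X k p0 U * X k pn U ∂(μs k)) - (∫ U, X k p0 U ∂(μs k)) * (∫ U, X k pn U ∂(μs k))) -
        ((∫ U, min (max (X k p0 U) 0) M * min (max (X k pn U) 0) M ∂(μs k)) -
          (∫ U, min (max (X k p0 U) 0) M ∂(μs k)) * (∫ U, min (max (X k pn U) 0) M ∂(μs k)))| ≤
        (96 * C + 32 * C ^ 2) / M := fun k M hM => by
    haveI := hprob k
    exact abs_cov_sub_truncated_le (hXm k p0) (hXm k pn) (hX0 k p0) (hX0 k pn) (hXB k p0) (hXB k pn)
      (hXe k p0) (hXe k pn) hM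
  -- the covariance of the scaled costs is `β²·plaquetteCorr`
  have hcov : ∀ k, (∫ U, X k p0 U * X k pn U ∂(μs k)) - (∫ U, X k p0 U ∂(μs k)) * (∫ U, X k pn U ∂(μs k)) =
      βs k ^ 2 * plaquetteCorr r.ρ (μs k) p0.1 p0.2.1.1 p0.2.1.2 pn.1 pn.2.1.1 pn.2.1.2 := fun k => by
    haveI := hprob k
    have h := cov_scaled_eq (μs k) (βs k) (r.N : ℝ) (hPi k p0) (hPi k pn) (hPPi k p0 pn)
    simpa only [hX, hP, plaquetteCorr] using h
  -- the Gaussian side: truncated covariances → `L`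
  have hGauss := GaussMoments.tendsto_truncated_cov D p0 pn
  have hKM : Tendsto (fun M : ℕ => (96 * C + 32 * C ^ 2) / (M : ℝ)) atTop (𝓝 0) :=
    tendsto_const_div_atTop_nhds_zero_nat _
  have hε3 : 0 < ε / 3 := by positivity
  obtain ⟨M, hM1, hMG, hMK⟩ : ∃ M : ℕ, 1 ≤ M ∧
      dist ((∫ Y, min (max ((1 / 2 : ℝ) * ∑ a : Fin D, (Y p0 a) ^ 2) 0) (M : ℝ) *
          min (max ((1 / 2 : ℝ) * ∑ b : Fin D, (Y pn b) ^ 2) 0) (M : ℝ) ∂(curvatureGaussianField 4 D)) -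
        (∫ Y, min (max ((1 / 2 : ℝ) * ∑ a : Fin D, (Y p0 a) ^ 2) 0) (M : ℝ) ∂(curvatureGaussianField 4 D)) *
          (∫ Y, min (max ((1 / 2 : ℝ) * ∑ b : Fin D, (Y pn b) ^ 2) 0) (M : ℝ) ∂(curvatureGaussianField 4 D)))
        L < ε / 3 ∧
      (96 * C + 32 * C ^ 2) / (M : ℝ) < ε / 3 :=
    ((eventually_ge_atTop 1).and (((Metric.tendsto_nhds.1 hGauss) (ε / 3) hε3).and
      (hKM.eventually (gt_mem_nhds hε3)))).exists
  have hM0 : (0 : ℝ) < M := by exact_mod_cast hM1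
  rw [Real.dist_eq] at hMG
  -- (T0) at the two plaquettes with the truncated test functions
  set cM : ℝ → ℝ := fun t => min (max t 0) (M : ℝ) with hcM
  have hcMc : Continuous cM := GaussMoments.continuous_clamp (M : ℝ)
  have hcMb : ∀ t, |cM t| ≤ M := fun t => GaussMoments.abs_clamp_le t (Nat.cast_nonneg M)
  set f2 : (Fin 2 → ℝ) → ℝ := fun v => cM (v 0) * cM (v 1) with hf2
  set fa : (Fin 2 → ℝ) → ℝ := fun v => cM (v 0) with hfa
  set fb : (Fin 2 → ℝ) → ℝ := fun v => cM (v 1) with hfb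
  have hf2c : Continuous f2 := (hcMc.comp (continuous_apply 0)).mul (hcMc.comp (continuous_apply 1))
  have hfac : Continuous fa := hcMc.comp (continuous_apply 0)
  have hfbc : Continuous fb := hcMc.comp (continuous_apply 1)
  have hf2b : ∃ C' : ℝ, ∀ v, |f2 v| ≤ C' := ⟨(M : ℝ) * M, fun v => by
    simp only [hf2, abs_mul]
    exact mul_le_mul (hcMb _) (hcMb _) (abs_nonneg _) (Nat.cast_nonneg M)⟩
  have hfab : ∃ C' : ℝ, ∀ v, |fa v| ≤ C' := ⟨M, fun v => hcMb _⟩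
  have hfbb : ∃ C' : ℝ, ∀ v, |fb v| ≤ C' := ⟨M, fun v => hcMb _⟩
  have l2 := hT0 2 ![p0, pn] f2 hf2c hf2b
  have la := hT0 2 ![p0, pn] fa hfac hfab
  have lb := hT0 2 ![p0, pn] fb hfbc hfbb
  -- identify the lattice integrands
  have hL2 : ∀ (j : ℕ) (U : LGConfig 4 G),
      f2 (fun i => βs (φ j) * ((r.N : ℝ) - plaquetteObs r.ρ
          ((![p0, pn] : Fin 2 → ZdPlaquette 4) i).1 ((![p0, pn] : Fin 2 → ZdPlaquette 4) i).2.1.1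
          ((![p0, pn] : Fin 2 → ZdPlaquette 4) i).2.1.2 U)) =
        cM (X (φ j) p0 U) * cM (X (φ j) pn U) := by
    intro j U
    simp only [hf2, hX, hP, Matrix.cons_val_zero, Matrix.cons_val_one, Matrix.cons_val_fin_one]
  have hLa : ∀ (j : ℕ) (U : LGConfig 4 G),
      fa (fun i => βs (φ j) * ((r.N : ℝ) - plaquetteObs r.ρ
          ((![p0, pn] : Fin 2 → ZdPlaquette 4) i).1 ((![p0, pn] : Fin 2 → ZdPlaquette 4) i).2.1.1
          ((![p0, pn] : Fin 2 → ZdPlaquette 4) i).2.1.2 U)) = cM (X (φ j) p0 U) := by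
    intro j U
    simp only [hfa, hX, hP, Matrix.cons_val_zero]
  have hLb : ∀ (j : ℕ) (U : LGConfig 4 G),
      fb (fun i => βs (φ j) * ((r.N : ℝ) - plaquetteObs r.ρ
          ((![p0, pn] : Fin 2 → ZdPlaquette 4) i).1 ((![p0, pn] : Fin 2 → ZdPlaquette 4) i).2.1.1
          ((![p0, pn] : Fin 2 → ZdPlaquette 4) i).2.1.2 U)) = cM (X (φ j) pn U) := by
    intro j U
    simp only [hfb, hX, hP, Matrix.cons_val_one, Matrix.cons_val_fin_one]
  -- identify the Gaussian integrands
  have hG2 : ∀ Y : ZdPlaquette 4 → Fin D → ℝ,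
      f2 (fun i => (1 / 2 : ℝ) * ∑ a : Fin D, (Y ((![p0, pn] : Fin 2 → ZdPlaquette 4) i) a) ^ 2) =
        cM ((1 / 2 : ℝ) * ∑ a : Fin D, (Y p0 a) ^ 2) * cM ((1 / 2 : ℝ) * ∑ b : Fin D, (Y pn b) ^ 2) := by
    intro Y
    simp only [hf2, Matrix.cons_val_zero, Matrix.cons_val_one, Matrix.cons_val_fin_one]
  have hGa : ∀ Y : ZdPlaquette 4 → Fin D → ℝ,
      fa (fun i => (1 / 2 : ℝ) * ∑ a : Fin D, (Y ((![p0, pn] : Fin 2 → ZdPlaquette 4) i) a) ^ 2) =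
        cM ((1 / 2 : ℝ) * ∑ a : Fin D, (Y p0 a) ^ 2) := by
    intro Y
    simp only [hfa, Matrix.cons_val_zero]
  have hGb : ∀ Y : ZdPlaquette 4 → Fin D → ℝ,
      fb (fun i => (1 / 2 : ℝ) * ∑ a : Fin D, (Y ((![p0, pn] : Fin 2 → ZdPlaquette 4) i) a) ^ 2) =
        cM ((1 / 2 : ℝ) * ∑ b : Fin D, (Y pn b) ^ 2) := by
    intro Y
    simp only [hfb, Matrix.cons_val_one, Matrix.cons_val_fin_one]
  simp only [hL2, hG2] at l2
  simp only [hLa, hGa] at la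
  simp only [hLb, hGb] at lb
  have lcov := l2.sub (la.mul lb)
  have hev := (Metric.tendsto_nhds.1 lcov) (ε / 3) hε3
  obtain ⟨j, hj⟩ := hev.exists
  rw [Real.dist_eq] at hj
  -- combine at `k = φ j`
  have hk := hbad (φ j)
  have h1 := htrunc (φ j) hM0
  rw [hcov (φ j)] at h1
  simp only [hcM] at hj
  have htri := abs_sub_le (βs (φ j) ^ 2 * plaquetteCorr r.ρ (μs (φ j)) p0.1 p0.2.1.1 p0.2.1.2 pn.1 pn.2.1.1 pn.2.1.2)
    ((∫ U, min (max (X (φ j) p0 U) 0) M * min (max (X (φ j) pn U) 0) M ∂(μs (φ j))) -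
      (∫ U, min (max (X (φ j) p0 U) 0) M ∂(μs (φ j))) * (∫ U, min (max (X (φ j) pn U) 0) M ∂(μs (φ j)))) L
  have htri2 := abs_sub_le
    ((∫ U, min (max (X (φ j) p0 U) 0) M * min (max (X (φ j) pn U) 0) M ∂(μs (φ j))) -
      (∫ U, min (max (X (φ j) p0 U) 0) M ∂(μs (φ j))) * (∫ U, min (max (X (φ j) pn U) 0) M ∂(μs (φ j))))
    ((∫ Y, min (max ((1 / 2 : ℝ) * ∑ a : Fin D, (Y p0 a) ^ 2) 0) (M : ℝ) *
          min (max ((1 / 2 : ℝ) * ∑ b : Fin D, (Y pn b) ^ 2) 0) (M : ℝ) ∂(curvatureGaussianField 4 D)) -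
        (∫ Y, min (max ((1 / 2 : ℝ) * ∑ a : Fin D, (Y p0 a) ^ 2) 0) (M : ℝ) ∂(curvatureGaussianField 4 D)) *
          (∫ Y, min (max ((1 / 2 : ℝ) * ∑ b : Fin D, (Y pn b) ^ 2) 0) (M : ℝ) ∂(curvatureGaussianField 4 D))) L
  linarith

/-- **One-sided corollary of the pair law.**  For every pair of plaquettes and every `ε > 0`: `−ε < β²·plaquetteCorr r.ρ μ x i j y k l`
for all large `β` and all limit states `μ` at `β` (the Gaussian limit `(D/2) c_{pq}²` is non-negative). [folklore] -/
theorem pairLocalLaw_lower :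
    ∀ (G : Type) [Group G] [TopologicalSpace G] [IsTopologicalGroup G] [CompactSpace G] [MeasurableSpace G] [BorelSpace G],
      IsCompactSimpleLieGroup G → ∀ r : LatticeRep G,
        ∀ (x y : Literature.Probability.LatticeModels.Site 4) (i j k l : Fin 4), i < j → k < l → ∀ ε : ℝ, 0 < ε →
          ∃ β₁ : ℝ, ∀ β : ℝ, β₁ ≤ β → ∀ μ ∈ infiniteVolumeLimitPoints (d := 4) r.ρ β,
            -ε < β ^ 2 * plaquetteCorr r.ρ μ x i j y k l := by
  intro G _ _ _ _ _ _ hG r x y i j k l hij hkl ε hε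
  obtain ⟨D, -, h⟩ := pairLocalLaw G hG r
  obtain ⟨β₁, hβ₁⟩ := h ⟨x, ⟨(i, j), hij⟩⟩ ⟨y, ⟨(k, l), hkl⟩⟩ ε hε
  refine ⟨β₁, fun β hβ μ hμ => ?_⟩
  have key := (abs_lt.1 (hβ₁ β hβ μ hμ)).1
  have hsq : 0 ≤ (D : ℝ) / 2 * curvatureTwoPoint (⟨x, ⟨(i, j), hij⟩⟩ : ZdPlaquette 4) ⟨y, ⟨(k, l), hkl⟩⟩ ^ 2 := by
    positivity
  dsimp only at key
  linarith

end PairLaw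

end Summit.QuantumFields.YangMills.Theorems.HankelDensitySplitting

end
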